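import Mathlib
import Literature.Combinatorics.SimpleGraph.LovaszTheta
import Literature.Combinatorics.SimpleGraph.LovaszThetaDual
import HarnessLib

/-!
# Orthonormal representations: Lovász's original definition of `ϑ` (Theorem 3), his proof
of `α ≤ ϑ` (Lemma 3), the tensor lemma (Lemma 4), and `ϑ(G) = max Σ (dᵀvᵢ)²` (Theorem 5)

Lovász (1979, §II) *defined* `ϑ(G)` through **orthonormal representations**: a system
`(u_i)_{i ∈ V}` of unit vectors in a Euclidean space with `u_i ⊥ u_j` whenever `i ≠ j` are
non-adjacent, together with a unit vector `c` (the *handle*); the *value* of `(u, c)` is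
`max_i 1/(cᵀu_i)²` and `ϑ(G)` is the minimum value over all representations (Knuth 1994, §1 and
§5 (5.2): the function `ϑ₁`, orthogonal labelings `a` of `G` with costs `c(a_v) = a_{1v}²/‖a_v‖²`).
This library takes the semidefinite maximum `ϑ(G) = max {𝟙ᵀB𝟙 : B ⪰ 0, Tr B = 1, B_{ij} = 0 on
E(G)}` (Lovász's Theorem 4, Knuth's `ϑ₃`) as the definition (`lovaszTheta`) and has the eigenvalue
form `ϑ = min Λ(A)` (Lovász's Theorem 3 (2), Knuth's `ϑ₂`) with attainment
(`exists_dual_of_lovaszTheta_eq`). This file closes the loop back to the original definition,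
with the matrix arguments of Lovász's proof of Theorem 3 (p. 2 part 1, p. 3 part 2):

* `IsOrthonormalRep G u` — orthonormal representations (vectors `u i : ι → ℝ`, dot products).
* `lovaszTheta_le_of_isOrthonormalRep` — **`ϑ(G) ≤ t` whenever some representation with unit
  handle `c` has `(cᵀu_i)² ≥ 1/t` for all `i`** (Theorem 3, part 1 of the proof: the matrix
  `a_{ij} = 1 - u_iᵀu_j/((cᵀu_i)(cᵀu_j))` is feasible for the eigenvalue bound and
  `tI - A = D + WᵀW` with `D ⪰ 0` diagonal, `W` the matrix of the vectors `c - u_i/(cᵀu_i)`);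
  stated junk-free as `1 ≤ t (cᵀu_i)²` rather than with `1/(cᵀu_i)²`.
* `exists_isOrthonormalRep_of_lovaszTheta` — **attainment**: a representation in `ℝ^{V ⊕ 1}`
  with unit handle and `cᵀu_i = 1/√ϑ(G)` for every `i` (part 2 of the proof: Gram vectors of
  `ϑ I - A ⪰ 0` plus one fresh coordinate for the handle; squared form `…_sq`); hence
  `isLeast_lovaszTheta_onr` and, with the finite maximum `onrValue u c = max_i 1/(cᵀu_i)²`,
  `lovaszTheta_le_onrValue` / `exists_onrValue_eq_lovaszTheta`: **`ϑ(G) = min_{(u,c)} max_i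
  1/(cᵀu_i)²`** (Lovász's definition; Knuth's Theorem §12 (12.1)–(12.2), `ϑ₁ = ϑ` with
  `c(a_v) = 1/ϑ`).
* `card_le_of_isOrthonormalRep` — Lovász's own proof of **Lemma 3, `α(G) ≤ ϑ(G)`**: the vectors
  of an independent set are pairwise orthogonal, so Bessel's inequality for the handle gives
  `|S|/t ≤ Σ_{i ∈ S} (cᵀu_i)² ≤ |c|² = 1`; `indepNum_le_of_isOrthonormalRep`.
* `sum_sq_mul_sq_le` — **Lemma 4** (Knuth §11 (11.1)): for representations `u` of `G` and `v` of
  `Ḡ` and any vectors `c`, `d`, `Σ_i (cᵀu_i)²(dᵀv_i)² ≤ |c|²|d|²` (the vectors `u_i ⊗ v_i` are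
  orthonormal; Bessel for `c ⊗ d`).
* `sum_sq_le_lovaszTheta` — **Corollary 1** (the inequality `≤ ϑ` of Theorem 5; Knuth §11 Lemma,
  `ϑ₄ ≤ ϑ`): for every orthonormal representation `v` of the complement `Gᶜ` and unit `d`,
  `Σ_i (dᵀv_i)² ≤ ϑ(G)` (Lemma 4 with an optimal `(u, c)`).
* `exists_isThetaFeasible_entrySum_eq` — the supremum defining `lovaszTheta` is a **maximum**
  (Theorem 4 says "max": the feasible region is a closed subset of the compact spectraplex,
  `isCompact_setOf_isSpectraplex`).
* `exists_isOrthonormalRep_compl_of_lovaszTheta`, `isGreatest_lovaszTheta_onr_compl` —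
  **Theorem 5**, `ϑ(G) = max_{(v,d)} Σ_i (dᵀv_i)²` over representations of `Ḡ`, attained in
  `ℝ^{V ⊕ V}` (Lovász's proof: Gram vectors `w_i` of an optimal `B`, `v_i = w_i/|w_i|`,
  `d = Σ w_i/√ϑ`, Cauchy–Schwarz); Knuth's `ϑ₄ = ϑ` (§10 (10.1), §12).
* Sanity: the constant representation of `K_n` gives `ϑ(K_n) ≤ 1` (`lovaszTheta_top_le_one`), the
  standard basis is a representation of every graph (`isOrthonormalRep_single`).

Sources: L. Lovász, *On the Shannon capacity of a graph*, IEEE Trans. Inform. Theory **25** (1979)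
1–7, §II p. 2 (definition, Lemma 3, Theorem 3 and part 1 of its proof), p. 3 (part 2, Theorem 4),
p. 4 (Lemma 4, Corollary 1, Theorem 5 with proof); D. E. Knuth, *The sandwich theorem*, Electron.
J. Combin. **1** (1994) A1, §1 (orthogonal labelings, cost), §3, §5 (5.2)–(5.3), §10 (10.1), §11
(11.1), §12 Theorem.
-/

noncomputable section

namespace Literature.Combinatorics.SimpleGraph.LovaszThetaOrthonormal

open Matrix Finset Literature.Combinatorics.SimpleGraph
open scoped MatrixOrder

variable {V ι κ : Type*}

/-! ### Orthonormal representations -/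

section Representations

variable [Fintype ι] [Fintype κ]

/-- An **orthonormal representation** of `G` (Lovász 1979, §II; Knuth 1994, §1: an orthogonal
labeling by unit vectors): unit vectors `u i : ι → ℝ` with `u i ⊥ u j` whenever `i ≠ j` are
non-adjacent in `G`. [cite: Lovasz1979, Sec. II] -/
structure IsOrthonormalRep (G : SimpleGraph V) (u : V → ι → ℝ) : Prop where
  /-- every vector is a unit vector -/
  dotProduct_self : ∀ i, u i ⬝ᵥ u i = 1
  /-- distinct non-adjacent vertices get orthogonal vectors -/
  dotProduct_eq_zero : ∀ ⦃i j : V⦄, i ≠ j → ¬G.Adj i j → u i ⬝ᵥ u j = 0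

/-- A representation of `G` is a representation of every supergraph on the same vertices (fewer
non-edges, fewer constraints; Knuth 1994, §3). [cite: Knuth1994, §3] -/
theorem IsOrthonormalRep.mono {G G' : SimpleGraph V} (h : G ≤ G') {u : V → ι → ℝ}
    (hu : IsOrthonormalRep G u) : IsOrthonormalRep G' u where
  dotProduct_self := hu.dotProduct_self
  dotProduct_eq_zero _ _ hij hadj := hu.dotProduct_eq_zero hij fun h' => hadj (h h')

/-- "Clearly, every graph has an orthonormal representation, for example, by pairwise orthogonal
vectors" (Lovász 1979, §II): the standard basis. [cite: Lovasz1979, Sec. II] -/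
theorem isOrthonormalRep_single [DecidableEq V] [Fintype V] (G : SimpleGraph V) :
    IsOrthonormalRep G (fun i : V => Pi.single i (1 : ℝ)) where
  dotProduct_self i := by rw [single_dotProduct, one_mul, Pi.single_eq_same]
  dotProduct_eq_zero i j hij _ := by rw [single_dotProduct, one_mul, Pi.single_eq_of_ne hij]

/-- In the complete graph all distinct vertices are adjacent, so any family of unit vectors — in
particular a constant one — is an orthonormal representation. [cite: Lovasz1979, Sec. II] -/
theorem isOrthonormalRep_top_const {c : ι → ℝ} (hc : c ⬝ᵥ c = 1) :
    IsOrthonormalRep (⊤ : SimpleGraph V) (fun _ : V => c) where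
  dotProduct_self _ := hc
  dotProduct_eq_zero i j hij hadj := (hadj ((SimpleGraph.top_adj i j).mpr hij)).elim

/-! ### Bessel's inequality and Lovász's proof of `α ≤ ϑ` (Lemma 3) -/

/-- Finite **Bessel inequality**: for a family `(e_i)_{i ∈ S}` of pairwise orthogonal unit
vectors and any `x`, `Σ_{i ∈ S} (xᵀe_i)² ≤ |x|²` (expand `|x - Σ (xᵀe_i) e_i|² ≥ 0`; Mathlib's
`Orthonormal.sum_inner_products_le` is the inner-product-space form, this is the `dotProduct`
form on `ι → ℝ` with orthonormality only on `S`). [folklore] -/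
@[folklore] private theorem sum_sq_dotProduct_le {S : Finset V} {e : V → ι → ℝ}
    (h1 : ∀ i ∈ S, e i ⬝ᵥ e i = 1) (h0 : ∀ i ∈ S, ∀ j ∈ S, i ≠ j → e i ⬝ᵥ e j = 0)
    (x : ι → ℝ) : ∑ i ∈ S, (x ⬝ᵥ e i) ^ 2 ≤ x ⬝ᵥ x := by
  set p : ι → ℝ := ∑ i ∈ S, (x ⬝ᵥ e i) • e i with hp
  have hxp : x ⬝ᵥ p = ∑ i ∈ S, (x ⬝ᵥ e i) ^ 2 := by
    rw [hp, dotProduct_sum]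
    exact sum_congr rfl fun i _ => by rw [dotProduct_smul, smul_eq_mul, sq]
  have hpp : p ⬝ᵥ p = ∑ i ∈ S, (x ⬝ᵥ e i) ^ 2 := by
    rw [hp, sum_dotProduct]
    refine sum_congr rfl fun i hi => ?_
    rw [dotProduct_sum, sum_eq_single_of_mem i hi]
    · rw [smul_dotProduct, dotProduct_smul, smul_eq_mul, smul_eq_mul, h1 i hi, mul_one, sq]
    · intro j hj hji
      rw [smul_dotProduct, dotProduct_smul, smul_eq_mul, smul_eq_mul, h0 i hi j hj (Ne.symm hji),
        mul_zero, mul_zero]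
  have hnn : 0 ≤ (x - p) ⬝ᵥ (x - p) := Finset.sum_nonneg fun k _ => mul_self_nonneg _
  rw [sub_dotProduct, dotProduct_sub, dotProduct_sub, hxp, hpp, dotProduct_comm p x, hxp] at hnn
  linarith

/-- If `(cᵀu_i)² ≥ 1/t` for every vertex of a nonempty graph, then `t > 0`. [folklore] -/
@[folklore] private theorem pos_of_forall_one_le [Nonempty V] {u : V → ι → ℝ} {c : ι → ℝ}
    {t : ℝ} (ht : ∀ i, 1 ≤ t * (c ⬝ᵥ u i) ^ 2) : 0 < t := by
  by_contra h
  have hi := ht (Classical.arbitrary V)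
  nlinarith [sq_nonneg (c ⬝ᵥ u (Classical.arbitrary V))]

/-- **Lovász's Lemma 3, his proof** (1979, p. 2): if `(u, c)` is an orthonormal representation of
`G` with unit handle and `(cᵀu_i)² ≥ 1/t` for all `i`, then every independent set `S` has
`|S| ≤ t` — the vectors `u_i`, `i ∈ S`, are pairwise orthogonal unit vectors, so
`1 = |c|² ≥ Σ_{i ∈ S} (cᵀu_i)² ≥ |S|/t` (Bessel). [cite: Lovasz1979, Lemma 3] -/
theorem card_le_of_isOrthonormalRep [Nonempty V] {G : SimpleGraph V} {u : V → ι → ℝ}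
    (hu : IsOrthonormalRep G u) {c : ι → ℝ} (hc : c ⬝ᵥ c = 1) {t : ℝ}
    (ht : ∀ i, 1 ≤ t * (c ⬝ᵥ u i) ^ 2) {S : Finset V} (hS : G.IsIndepSet ↑S) :
    (S.card : ℝ) ≤ t := by
  have ht0 : 0 < t := pos_of_forall_one_le ht
  have hB := sum_sq_dotProduct_le (fun i _ => hu.dotProduct_self i)
    (fun i hi j hj hij => hu.dotProduct_eq_zero hij (hS hi hj hij)) c
  rw [hc] at hB
  calc (S.card : ℝ) = ∑ _i ∈ S, (1 : ℝ) := by simp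
    _ ≤ ∑ i ∈ S, t * (c ⬝ᵥ u i) ^ 2 := sum_le_sum fun i _ => ht i
    _ = t * ∑ i ∈ S, (c ⬝ᵥ u i) ^ 2 := by rw [mul_sum]
    _ ≤ t * 1 := mul_le_mul_of_nonneg_left hB ht0.le
    _ = t := mul_one t

/-- **`α(G) ≤ t`** for every orthonormal representation with unit handle and `(cᵀu_i)² ≥ 1/t`
(Lovász 1979, Lemma 3: `α(G) ≤ ϑ(G)`, applied before minimising over representations).
[cite: Lovasz1979, Lemma 3] -/
theorem indepNum_le_of_isOrthonormalRep [Fintype V] [Nonempty V] {G : SimpleGraph V}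
    {u : V → ι → ℝ} (hu : IsOrthonormalRep G u) {c : ι → ℝ} (hc : c ⬝ᵥ c = 1) {t : ℝ}
    (ht : ∀ i, 1 ≤ t * (c ⬝ᵥ u i) ^ 2) : (G.indepNum : ℝ) ≤ t := by
  classical
  obtain ⟨S, hS⟩ := G.exists_isNIndepSet_indepNum
  rw [← hS.card_eq]
  exact card_le_of_isOrthonormalRep hu hc ht hS.isIndepSet

/-! ### Lemma 4: representations of `G` and `Ḡ` -/

/-- The tensor (Kronecker) product of two coordinate vectors. [folklore] -/
@[folklore] private def tens (x : ι → ℝ) (y : κ → ℝ) : ι × κ → ℝ := fun p => x p.1 * y p.2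

/-- `(x ⊗ y)ᵀ(x' ⊗ y') = (xᵀx')(yᵀy')` (Lovász 1979, (1)). [folklore] -/
@[folklore] private theorem tens_dotProduct_tens (x x' : ι → ℝ) (y y' : κ → ℝ) :
    tens x y ⬝ᵥ tens x' y' = (x ⬝ᵥ x') * (y ⬝ᵥ y') := by
  simp only [dotProduct, tens, Fintype.sum_prod_type, Finset.sum_mul_sum]
  exact Finset.sum_congr rfl fun i _ => Finset.sum_congr rfl fun j _ => by ring

/-- **Lovász's Lemma 4** (1979, p. 4; Knuth 1994, §11 (11.1) `Σ_v c(a_v) c(b_v) ≤ 1`): if `u` is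
an orthonormal representation of `G` and `v` one of the complement `Ḡ`, then for all vectors
`c`, `d`,
`Σ_i (cᵀu_i)² (dᵀv_i)² ≤ |c|² |d|²`. Proof: the vectors `u_i ⊗ v_i` are orthonormal (for
`i ≠ j` one of `u_iᵀu_j`, `v_iᵀv_j` vanishes), and `(c ⊗ d)ᵀ(u_i ⊗ v_i) = (cᵀu_i)(dᵀv_i)`;
apply Bessel to `c ⊗ d`. [cite: Lovasz1979, Lemma 4] -/
theorem sum_sq_mul_sq_le [Fintype V] {G : SimpleGraph V} {u : V → ι → ℝ}
    {v : V → κ → ℝ} (hu : IsOrthonormalRep G u) (hv : IsOrthonormalRep Gᶜ v) (c : ι → ℝ)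
    (d : κ → ℝ) :
    ∑ i, (c ⬝ᵥ u i) ^ 2 * (d ⬝ᵥ v i) ^ 2 ≤ (c ⬝ᵥ c) * (d ⬝ᵥ d) := by
  have hB := sum_sq_dotProduct_le (S := Finset.univ) (e := fun i => tens (u i) (v i))
    (fun i _ => by rw [tens_dotProduct_tens, hu.dotProduct_self, hv.dotProduct_self, one_mul])
    (fun i _ j _ hij => by
      rw [tens_dotProduct_tens]
      by_cases hadj : G.Adj i j
      · rw [hv.dotProduct_eq_zero hij fun h => ((SimpleGraph.compl_adj _ _ _).mp h).2 hadj,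
          mul_zero]
      · rw [hu.dotProduct_eq_zero hij hadj, zero_mul])
    (tens c d)
  rw [tens_dotProduct_tens] at hB
  refine le_of_eq_of_le (Finset.sum_congr rfl fun i _ => ?_) hB
  rw [tens_dotProduct_tens, mul_pow]

end Representations

/-! ### Theorem 3, part 1: a representation with handle bounds `ϑ` from above -/

section UpperBound

variable [Fintype V] [DecidableEq V] [Fintype ι]

/-- **Lovász's matrix of a representation with handle** (1979, proof of Theorem 3, part 1):
`a_{ij} = 1 - u_iᵀu_j / ((cᵀu_i)(cᵀu_j))` for `i ≠ j` and `a_{ii} = 1`; it equals `1` on the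
diagonal and on non-adjacent pairs (`u_i ⊥ u_j`), so it is feasible for the eigenvalue bound
(`IsThetaDualFeasible`). [cite: Lovasz1979, Theorem 3] -/
def onrMatrix (u : V → ι → ℝ) (c : ι → ℝ) : Matrix V V ℝ :=
  of fun i j => if i = j then 1 else 1 - (u i ⬝ᵥ u j) / ((c ⬝ᵥ u i) * (c ⬝ᵥ u j))

omit [Fintype V] in
/-- Lovász's matrix is symmetric with `a_{ij} = 1` for `i = j` or `i`, `j` non-adjacent: dual
feasible. [cite: Lovasz1979, Theorem 3] -/
theorem isThetaDualFeasible_onrMatrix {G : SimpleGraph V} {u : V → ι → ℝ}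
    (hu : IsOrthonormalRep G u) (c : ι → ℝ) : IsThetaDualFeasible G (onrMatrix u c) where
  isHermitian := by
    refine Matrix.IsHermitian.ext fun i j => ?_
    rw [star_trivial]
    by_cases hij : i = j
    · subst hij; rfl
    · simp only [onrMatrix, of_apply, if_neg hij, if_neg (Ne.symm hij),
        dotProduct_comm (u j) (u i), mul_comm (c ⬝ᵥ u j) (c ⬝ᵥ u i)]
  apply_eq_one i j hadj := by
    by_cases hij : i = j
    · simp [onrMatrix, hij]
    · simp [onrMatrix, hij, hu.dotProduct_eq_zero hij hadj]

/-- The vectors `w_i = c - u_i/(cᵀu_i)` of Lovász's proof. [folklore] -/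
@[folklore] private def wVec (u : V → ι → ℝ) (c : ι → ℝ) (i : V) : ι → ℝ :=
  c - (c ⬝ᵥ u i)⁻¹ • u i

/-- The matrix `W` whose columns are the `w_i`. [folklore] -/
@[folklore] private def wMat (u : V → ι → ℝ) (c : ι → ℝ) : Matrix ι V ℝ :=
  of fun k i => wVec u c i k

omit [Fintype V] [DecidableEq V] in
/-- `(WᵀW)_{ij} = w_iᵀw_j`. [folklore] -/
@[folklore] private theorem conjTranspose_wMat_mul_apply (u : V → ι → ℝ) (c : ι → ℝ)
    (i j : V) : ((wMat u c)ᴴ * wMat u c) i j = wVec u c i ⬝ᵥ wVec u c j := by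
  simp [Matrix.mul_apply, wMat, dotProduct]

omit [Fintype V] [DecidableEq V] in
/-- `w_iᵀw_j = u_iᵀu_j/((cᵀu_i)(cᵀu_j)) - 1` for a unit handle (Lovász: `-a_{ij} = w_iᵀw_j`,
`|w_i|² = 1/(cᵀu_i)² - 1`). [folklore] -/
@[folklore] private theorem wVec_dotProduct_wVec {u : V → ι → ℝ} {c : ι → ℝ} (hc : c ⬝ᵥ c = 1)
    (h0 : ∀ i, c ⬝ᵥ u i ≠ 0) (i j : V) :
    wVec u c i ⬝ᵥ wVec u c j = (c ⬝ᵥ u i)⁻¹ * (c ⬝ᵥ u j)⁻¹ * (u i ⬝ᵥ u j) - 1 := by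
  have hi := h0 i
  have hj := h0 j
  simp only [wVec, sub_dotProduct, dotProduct_sub, smul_dotProduct, dotProduct_smul, smul_eq_mul,
    hc, dotProduct_comm (u i) c]
  field_simp
  ring

omit [Fintype V] in
/-- **`tI - A = D + WᵀW`** with `D = diag(t - 1/(cᵀu_i)²)`: the decomposition behind Lovász's
"`ϑI - A` is positive semidefinite" (proof of Theorem 3, part 1). [cite: Lovasz1979, Theorem 3] -/
theorem smul_one_sub_onrMatrix_eq {G : SimpleGraph V} {u : V → ι → ℝ}
    (hu : IsOrthonormalRep G u) {c : ι → ℝ} (hc : c ⬝ᵥ c = 1) (h0 : ∀ i, c ⬝ᵥ u i ≠ 0)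
    (t : ℝ) :
    t • (1 : Matrix V V ℝ) - onrMatrix u c =
      diagonal (fun i => t - ((c ⬝ᵥ u i) ^ 2)⁻¹) + (wMat u c)ᴴ * wMat u c := by
  ext i j
  rw [Matrix.sub_apply, Matrix.smul_apply, Matrix.add_apply, conjTranspose_wMat_mul_apply,
    wVec_dotProduct_wVec hc h0, smul_eq_mul]
  by_cases hij : i = j
  · subst hij
    rw [one_apply_eq, diagonal_apply_eq, hu.dotProduct_self, onrMatrix, of_apply, if_pos rfl]
    ring
  · rw [one_apply_ne hij, diagonal_apply_ne _ hij, onrMatrix, of_apply, if_neg hij]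
    have hi := h0 i
    have hj := h0 j
    field_simp
    ring

/-- **`tI - A ⪰ 0`** when `(cᵀu_i)² ≥ 1/t` for all `i` (Lovász 1979, proof of Theorem 3, part 1:
`D ⪰ 0` entrywise and `WᵀW ⪰ 0`). [cite: Lovasz1979, Theorem 3] -/
theorem posSemidef_smul_one_sub_onrMatrix {G : SimpleGraph V} {u : V → ι → ℝ}
    (hu : IsOrthonormalRep G u) {c : ι → ℝ} (hc : c ⬝ᵥ c = 1) {t : ℝ}
    (ht : ∀ i, 1 ≤ t * (c ⬝ᵥ u i) ^ 2) :
    (t • (1 : Matrix V V ℝ) - onrMatrix u c).PosSemidef := by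
  have h0 : ∀ i, c ⬝ᵥ u i ≠ 0 := fun i h => by
    have h1 := ht i
    rw [h] at h1
    norm_num at h1
  rw [smul_one_sub_onrMatrix_eq hu hc h0 t]
  refine PosSemidef.add (PosSemidef.diagonal fun i => ?_) (posSemidef_conjTranspose_mul_self _)
  have hx : 0 < (c ⬝ᵥ u i) ^ 2 := by
    have := h0 i
    positivity
  show 0 ≤ t - ((c ⬝ᵥ u i) ^ 2)⁻¹
  rw [sub_nonneg, inv_eq_one_div, div_le_iff₀ hx]
  exact ht i

/-- **Lovász's Theorem 3, part 1 — a representation bounds `ϑ`:** if `(u_i)` is an orthonormal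
representation of `G` and `c` a unit vector with `(cᵀu_i)² ≥ 1/t` for every `i` (i.e. the value
`max_i 1/(cᵀu_i)²` is at most `t`), then `ϑ(G) ≤ t`. Proof: `A = onrMatrix u c` is dual feasible
with `tI - A ⪰ 0`, and `ϑ ≤ Λ(A)` by weak duality (`lovaszTheta_le_of_dual`; Lovász obtains it
from his definition, Knuth 1994 §5 (5.2) calls the minimum value `ϑ₁`).
[cite: Lovasz1979, Theorem 3] -/
theorem lovaszTheta_le_of_isOrthonormalRep [Nonempty V] {G : SimpleGraph V} {u : V → ι → ℝ}
    (hu : IsOrthonormalRep G u) {c : ι → ℝ} (hc : c ⬝ᵥ c = 1) {t : ℝ}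
    (ht : ∀ i, 1 ≤ t * (c ⬝ᵥ u i) ^ 2) : lovaszTheta G ≤ t :=
  lovaszTheta_le_of_dual (isThetaDualFeasible_onrMatrix hu c)
    (posSemidef_smul_one_sub_onrMatrix hu hc ht) (pos_of_forall_one_le ht).le

/-- Sanity check: the constant representation `u_i = c` of `K_n` (value `1`) gives `ϑ(K_n) ≤ 1`.
[cite: Lovasz1979, Theorem 3] -/
theorem lovaszTheta_top_le_one [Nonempty V] : lovaszTheta (⊤ : SimpleGraph V) ≤ 1 := by
  have hc : (fun _ : Unit => (1 : ℝ)) ⬝ᵥ (fun _ : Unit => (1 : ℝ)) = 1 := by simp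
  exact lovaszTheta_le_of_isOrthonormalRep (isOrthonormalRep_top_const hc) hc fun _ => by
    rw [hc]; norm_num

/-- **The value** `max_i 1/(cᵀu_i)²` of a representation with handle (Lovász 1979, §II), as a
finite maximum over the (nonempty) vertex set; meaningful when every `cᵀu_i ≠ 0` (Lovász's
value is `+∞` otherwise, while here `1/0 = 0`). [cite: Lovasz1979, Sec. II] -/
def onrValue [Nonempty V] (u : V → ι → ℝ) (c : ι → ℝ) : ℝ :=
  Finset.univ.sup' Finset.univ_nonempty fun i => ((c ⬝ᵥ u i) ^ 2)⁻¹

/-- **`ϑ(G) ≤ max_i 1/(cᵀu_i)²`** for every orthonormal representation of `G` with unit handle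
meeting every `u_i` (Lovász 1979, §II with Theorem 3; Knuth 1994, §5 Lemma `ϑ ≤ ϑ₁`).
[cite: Lovasz1979, Theorem 3] -/
theorem lovaszTheta_le_onrValue [Nonempty V] {G : SimpleGraph V} {u : V → ι → ℝ}
    (hu : IsOrthonormalRep G u) {c : ι → ℝ} (hc : c ⬝ᵥ c = 1) (h0 : ∀ i, c ⬝ᵥ u i ≠ 0) :
    lovaszTheta G ≤ onrValue u c :=
  lovaszTheta_le_of_isOrthonormalRep hu hc fun i => by
    have hx : 0 < (c ⬝ᵥ u i) ^ 2 := by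
      have := h0 i
      positivity
    have h : ((c ⬝ᵥ u i) ^ 2)⁻¹ ≤ onrValue u c :=
      Finset.le_sup' (fun i => ((c ⬝ᵥ u i) ^ 2)⁻¹) (Finset.mem_univ i)
    rwa [inv_eq_one_div, div_le_iff₀ hx] at h

end UpperBound

/-! ### Theorem 3, part 2: an optimal representation in `ℝ^{V ⊕ 1}` -/

section Attainment

variable [Fintype V] [DecidableEq V]

/-- Append one coordinate: `lift a x = (x, a) ∈ ℝ^{V ⊕ 1}` (indexed by `Option V`, the new
coordinate at `none`). [folklore] -/
@[folklore] private def lift (a : ℝ) (x : V → ℝ) : Option V → ℝ := fun o => o.elim a x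

omit [DecidableEq V] in
/-- `(x, a)ᵀ(y, b) = ab + xᵀy`. [folklore] -/
@[folklore] private theorem lift_dotProduct_lift (a b : ℝ) (x y : V → ℝ) :
    lift a x ⬝ᵥ lift b y = a * b + x ⬝ᵥ y := by
  simp [dotProduct, Fintype.sum_option, lift]

/-- A real positive semidefinite matrix is a Gram matrix: `M = SᴴS` (here via the positive square
root of the continuous functional calculus). [folklore] -/
@[folklore] private theorem exists_conjTranspose_mul_self_eq {M : Matrix V V ℝ}
    (hM : M.PosSemidef) : ∃ S : Matrix V V ℝ, Sᴴ * S = M := by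
  have h0 : 0 ≤ M := Matrix.nonneg_iff_posSemidef.mpr hM
  refine ⟨CFC.sqrt M, ?_⟩
  have h1 : (CFC.sqrt M).PosSemidef := Matrix.nonneg_iff_posSemidef.mp (CFC.sqrt_nonneg M)
  rw [h1.1.eq]
  exact CFC.sqrt_mul_sqrt_self M h0

/-- **Lovász's Theorem 3, part 2 — an optimal representation exists:** there are an orthonormal
representation `(u_i)` of `G` in `ℝ^{V ⊕ 1}` and a unit handle `c` with `cᵀu_i = 1/√ϑ(G)` for
every `i` (value exactly `ϑ(G)`). Proof (1979, p. 3): take a dual-optimal `A` with `ϑI - A ⪰ 0`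
(`exists_dual_of_lovaszTheta_eq`), Gram vectors `x_i` with `x_iᵀx_j = ϑδ_{ij} - a_{ij}`, a fresh
unit coordinate `c ⊥ x_i`, and `u_i = (c + x_i)/√ϑ`: then `|u_i|² = (1 + ϑ - 1)/ϑ = 1`,
`u_iᵀu_j = (1 + x_iᵀx_j)/ϑ = 0` for non-adjacent `i ≠ j`, and `(cᵀu_i)² = 1/ϑ` (Knuth 1994, §12
(12.2): `c(a_v) = w_v/ϑ`). [cite: Lovasz1979, Theorem 3] -/
theorem exists_isOrthonormalRep_of_lovaszTheta [Nonempty V] (G : SimpleGraph V) :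
    ∃ (u : V → Option V → ℝ) (c : Option V → ℝ),
      IsOrthonormalRep G u ∧ c ⬝ᵥ c = 1 ∧ ∀ i, c ⬝ᵥ u i = (Real.sqrt (lovaszTheta G))⁻¹ := by
  classical
  set θ := lovaszTheta G with hθ
  have hθ0 : 0 < θ := one_pos.trans_le (one_le_lovaszTheta G)
  obtain ⟨A, hA, hpsd⟩ := exists_dual_of_lovaszTheta_eq G
  obtain ⟨S, hS⟩ := exists_conjTranspose_mul_self_eq hpsd
  -- the Gram vectors `x_i` (columns of `S`): `x_iᵀx_j = (ϑI - A)_{ij}`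
  set x : V → V → ℝ := fun i k => S k i with hx
  have hxx : ∀ i j, x i ⬝ᵥ x j = (θ • (1 : Matrix V V ℝ) - A) i j := by
    intro i j
    rw [← hS, mul_apply]
    simp only [conjTranspose_apply, star_trivial, dotProduct, hx]
  set s := (Real.sqrt θ)⁻¹ with hs
  have hs2 : s ^ 2 = θ⁻¹ := by rw [hs, inv_pow, Real.sq_sqrt hθ0.le]
  refine ⟨fun i => lift s (s • x i), lift 1 0, ⟨fun i => ?_, fun i j hij hadj => ?_⟩, ?_,
    fun i => ?_⟩
  · rw [lift_dotProduct_lift, smul_dotProduct, dotProduct_smul, smul_eq_mul, smul_eq_mul, hxx,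
      Matrix.sub_apply, Matrix.smul_apply, one_apply_eq, hA.apply_self, smul_eq_mul, mul_one]
    have h : s * s + s * (s * (θ - 1)) = s ^ 2 * θ := by ring
    rw [h, hs2, inv_mul_cancel₀ hθ0.ne']
  · rw [lift_dotProduct_lift, smul_dotProduct, dotProduct_smul, smul_eq_mul, smul_eq_mul, hxx,
      Matrix.sub_apply, Matrix.smul_apply, one_apply_ne hij, hA.apply_eq_one hadj, smul_eq_mul,
      mul_zero]
    ring
  · rw [lift_dotProduct_lift, dotProduct_zero]
    ring
  · rw [lift_dotProduct_lift, zero_dotProduct, add_zero, one_mul]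

/-- The same optimum in squared form: `ϑ(G)·(cᵀu_i)² = 1` for every `i`.
[cite: Lovasz1979, Theorem 3] -/
theorem exists_isOrthonormalRep_of_lovaszTheta_sq [Nonempty V] (G : SimpleGraph V) :
    ∃ (u : V → Option V → ℝ) (c : Option V → ℝ),
      IsOrthonormalRep G u ∧ c ⬝ᵥ c = 1 ∧ ∀ i, lovaszTheta G * (c ⬝ᵥ u i) ^ 2 = 1 := by
  obtain ⟨u, c, hu, hc, h⟩ := exists_isOrthonormalRep_of_lovaszTheta G
  have hθ0 : 0 < lovaszTheta G := one_pos.trans_le (one_le_lovaszTheta G)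
  exact ⟨u, c, hu, hc, fun i => by
    rw [h i, inv_pow, Real.sq_sqrt hθ0.le, mul_inv_cancel₀ hθ0.ne']⟩

/-- **Lovász's definition of `ϑ` recovered** (1979, §II with Theorem 3; Knuth 1994, §12 Theorem,
`ϑ₁ = ϑ`): `ϑ(G)` is the least `t` for which some orthonormal representation of `G` (in
`ℝ^{V ⊕ 1}`, which suffices) with unit handle has `(cᵀu_i)² ≥ 1/t` for all `i` — i.e.
`ϑ(G) = min_{(u, c)} max_i 1/(cᵀu_i)²`, the minimum being attained. [cite: Lovasz1979, Theorem 3] -/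
theorem isLeast_lovaszTheta_onr [Nonempty V] (G : SimpleGraph V) :
    IsLeast {t : ℝ | ∃ (u : V → Option V → ℝ) (c : Option V → ℝ),
      IsOrthonormalRep G u ∧ c ⬝ᵥ c = 1 ∧ ∀ i, 1 ≤ t * (c ⬝ᵥ u i) ^ 2} (lovaszTheta G) := by
  refine ⟨?_, fun t ⟨u, c, hu, hc, ht⟩ => lovaszTheta_le_of_isOrthonormalRep hu hc ht⟩
  obtain ⟨u, c, hu, hc, h⟩ := exists_isOrthonormalRep_of_lovaszTheta_sq G
  exact ⟨u, c, hu, hc, fun i => (h i).ge⟩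

/-- **`ϑ(G) = min value`**, the value as the finite maximum `onrValue`: some representation in
`ℝ^{V ⊕ 1}` with unit handle meets every `u_i` and has `max_i 1/(cᵀu_i)² = ϑ(G)` (and no
representation does better, `lovaszTheta_le_onrValue`). [cite: Lovasz1979, Theorem 3] -/
theorem exists_onrValue_eq_lovaszTheta [Nonempty V] (G : SimpleGraph V) :
    ∃ (u : V → Option V → ℝ) (c : Option V → ℝ), IsOrthonormalRep G u ∧ c ⬝ᵥ c = 1 ∧
      (∀ i, c ⬝ᵥ u i ≠ 0) ∧ onrValue u c = lovaszTheta G := by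
  obtain ⟨u, c, hu, hc, h⟩ := exists_isOrthonormalRep_of_lovaszTheta_sq G
  have hval : ∀ i, ((c ⬝ᵥ u i) ^ 2)⁻¹ = lovaszTheta G := fun i => by
    rw [eq_inv_of_mul_eq_one_right (h i), inv_inv]
  refine ⟨u, c, hu, hc, fun i hi => ?_,
    le_antisymm (Finset.sup'_le _ _ fun i _ => (hval i).le) ?_⟩
  · have h1 := h i
    rw [hi] at h1
    norm_num at h1
  · exact (hval (Classical.arbitrary V)).ge.trans
      (Finset.le_sup' (fun i => ((c ⬝ᵥ u i) ^ 2)⁻¹) (Finset.mem_univ _))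

/-! ### Corollary 1: representations of the complement bound `ϑ` from below -/

/-- **Lovász's Corollary 1** (1979, p. 4; the inequality `≥` of his Theorem 5
`ϑ(G) = max Σ_i (dᵀv_i)²`; Knuth 1994, §11 Lemma `ϑ₄ ≤ ϑ`): if `(v_i)` is an orthonormal
representation of the complement `Ḡ` and `d` a unit vector, then `Σ_i (dᵀv_i)² ≤ ϑ(G)`. Proof:
Lemma 4 with an optimal `(u, c)` for `G` (`(cᵀu_i)² = 1/ϑ`): `ϑ⁻¹ Σ_i (dᵀv_i)² ≤ |c|²|d|² = 1`.
[cite: Lovasz1979, Corollary 1] -/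
theorem sum_sq_le_lovaszTheta [Fintype κ] {G : SimpleGraph V} {v : V → κ → ℝ}
    (hv : IsOrthonormalRep Gᶜ v) {d : κ → ℝ} (hd : d ⬝ᵥ d = 1) :
    ∑ i, (d ⬝ᵥ v i) ^ 2 ≤ lovaszTheta G := by
  rcases isEmpty_or_nonempty V with hV | hV
  · simp [lovaszTheta_nonneg]
  obtain ⟨u, c, hu, hc, h⟩ := exists_isOrthonormalRep_of_lovaszTheta_sq G
  have hθ0 : 0 < lovaszTheta G := one_pos.trans_le (one_le_lovaszTheta G)
  have h4 := sum_sq_mul_sq_le hu hv c d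
  have hci : ∀ i, (c ⬝ᵥ u i) ^ 2 = (lovaszTheta G)⁻¹ := fun i => eq_inv_of_mul_eq_one_right (h i)
  simp only [hci, hc, hd, mul_one, ← Finset.mul_sum] at h4
  have h5 := mul_le_mul_of_nonneg_left h4 hθ0.le
  rwa [← mul_assoc, mul_inv_cancel₀ hθ0.ne', one_mul, mul_one] at h5

/-- In particular (`d = v_{i₀}`): **every orthonormal representation of `Ḡ` has
`Σ_i (v_{i₀}ᵀv_i)² ≤ ϑ(G)`**, so `1 ≤ ϑ(G)` once more, and an orthonormal representation of `Ḡ`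
by `k` copies of one unit vector on a clique of `G` forces `k ≤ ϑ(G)`.
[cite: Lovasz1979, Corollary 1] -/
theorem sum_sq_dotProduct_le_lovaszTheta [Fintype κ] {G : SimpleGraph V} {v : V → κ → ℝ}
    (hv : IsOrthonormalRep Gᶜ v) (i₀ : V) : ∑ i, (v i₀ ⬝ᵥ v i) ^ 2 ≤ lovaszTheta G :=
  sum_sq_le_lovaszTheta hv (hv.dotProduct_self i₀)

end Attainment

/-! ### Theorem 4's maximum is attained; Theorem 5 with its maximum -/

section Theorem5

variable [Fintype V] [DecidableEq V]

/-- **The maximum in Lovász's Theorem 4 is attained**: the feasible region of the defining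
programme `{B ⪰ 0, Tr B = 1, B_{ij} = 0 on E(G)}` is a closed subset of the (compact) spectraplex
and is nonempty, so some feasible `B` has `Σ_{ij} B_{ij} = ϑ(G)` (Lovász 1979, Theorem 4: "max";
`lovaszTheta` is defined as the supremum). [cite: Lovasz1979, Theorem 4] -/
theorem exists_isThetaFeasible_entrySum_eq [Nonempty V] (G : SimpleGraph V) :
    ∃ B : Matrix V V ℝ, IsThetaFeasible G B ∧ entrySum B = lovaszTheta G := by
  classical
  set S : Set (Matrix V V ℝ) := {B | IsThetaFeasible G B} with hS
  have hZ : IsClosed {B : Matrix V V ℝ | ∀ u v, G.Adj u v → B u v = 0} := by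
    have h : {B : Matrix V V ℝ | ∀ u v, G.Adj u v → B u v = 0} =
        ⋂ u, ⋂ v, {B : Matrix V V ℝ | G.Adj u v → B u v = 0} := by
      ext B
      simp only [Set.mem_setOf_eq, Set.mem_iInter]
    rw [h]
    refine isClosed_iInter fun u => isClosed_iInter fun v => ?_
    by_cases huv : G.Adj u v
    · simp only [huv, forall_true_left]
      exact isClosed_eq ((continuous_apply v).comp (continuous_apply u)) continuous_const
    · simp only [huv, IsEmpty.forall_iff, Set.setOf_true, isClosed_univ]
  have hSc : IsCompact S := by
    have hSeq : S = {B : Matrix V V ℝ | IsSpectraplex B} ∩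
        {B : Matrix V V ℝ | ∀ u v, G.Adj u v → B u v = 0} := by
      ext B
      simp only [hS, Set.mem_setOf_eq, Set.mem_inter_iff]
      exact ⟨fun hB => ⟨IsSpectraplex.of_isThetaFeasible hB, fun u v => @hB.apply_eq_zero u v⟩,
        fun h => ⟨h.1.posSemidef, h.1.trace_eq_one, fun u v => h.2 u v⟩⟩
    rw [hSeq]
    exact isCompact_setOf_isSpectraplex.inter_right hZ
  have hne : S.Nonempty := ⟨_, isThetaFeasible_smul_one G⟩
  have hcont : Continuous fun B : Matrix V V ℝ => entrySum B :=
    continuous_finsetSum _ fun u _ => continuous_finsetSum _ fun v _ =>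
      (continuous_apply v).comp (continuous_apply u)
  obtain ⟨B, hB, hmax⟩ := hSc.exists_isMaxOn hne hcont.continuousOn
  refine ⟨B, hB, le_antisymm (le_csSup (bddAbove_thetaValues G) ⟨B, hB, rfl⟩) ?_⟩
  unfold lovaszTheta
  refine csSup_le (hne.image _) ?_
  rintro _ ⟨B', hB', rfl⟩
  exact (isMaxOn_iff.mp hmax) B' hB'

/-- **Lovász's Theorem 5, the maximum is attained** (1979, p. 4): there are an orthonormal
representation `(v_i)` of the complement `Ḡ` (in `ℝ^{V ⊕ V}`) and a unit vector `d` with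
`Σ_i (dᵀv_i)² = ϑ(G)`. Proof as in the paper: take an optimal `B` of Theorem 4
(`exists_isThetaFeasible_entrySum_eq`) with Gram vectors `w_i` (`w_iᵀw_j = b_{ij}`, so
`Σ|w_i|² = 1`, `|Σ w_i|² = ϑ`, and `w_i ⊥ w_j` on edges of `G`), `v_i = w_i/|w_i|`,
`d = (Σ w_i)/√ϑ`; then Cauchy–Schwarz gives `Σ(dᵀv_i)² = (Σ|w_i|²)(Σ(dᵀv_i)²) ≥ (Σ|w_i| dᵀv_i)² =
(dᵀΣ w_i)² = ϑ`, and `≤` is Corollary 1. (Vanishing `w_i` get fresh basis vectors in the second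
summand of `ℝ^{V ⊕ V}`, contributing `0`.) [cite: Lovasz1979, Theorem 5] -/
theorem exists_isOrthonormalRep_compl_of_lovaszTheta [Nonempty V] (G : SimpleGraph V) :
    ∃ (v : V → V ⊕ V → ℝ) (d : V ⊕ V → ℝ),
      IsOrthonormalRep Gᶜ v ∧ d ⬝ᵥ d = 1 ∧ ∑ i, (d ⬝ᵥ v i) ^ 2 = lovaszTheta G := by
  classical
  obtain ⟨B, hB, hsum⟩ := exists_isThetaFeasible_entrySum_eq G
  obtain ⟨S, hS⟩ := exists_conjTranspose_mul_self_eq hB.posSemidef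
  set θ := lovaszTheta G with hθ
  have hθ0 : 0 < θ := one_pos.trans_le (one_le_lovaszTheta G)
  -- Gram vectors `w_i` of `B`
  set w : V → V → ℝ := fun i k => S k i with hw
  have hww : ∀ i j, w i ⬝ᵥ w j = B i j := by
    intro i j
    rw [← hS, mul_apply]
    simp only [conjTranspose_apply, star_trivial, dotProduct, hw]
  have hq1 : ∑ i, w i ⬝ᵥ w i = 1 := by
    rw [← hB.trace_eq_one, Matrix.trace]
    exact sum_congr rfl fun i _ => by rw [hww, diag_apply]
  have hq0 : ∀ i, 0 ≤ w i ⬝ᵥ w i := fun i => Finset.sum_nonneg fun k _ => mul_self_nonneg _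
  -- `z = Σ w_i`, `|z|² = ϑ`
  set z : V → ℝ := ∑ j, w j with hz
  have hzz : z ⬝ᵥ z = θ := by
    rw [← hsum, entrySum, hz, sum_dotProduct]
    exact sum_congr rfl fun i _ => by
      rw [dotProduct_sum]
      exact sum_congr rfl fun j _ => hww i j
  have hzs : ∑ i, z ⬝ᵥ w i = θ := by rw [← dotProduct_sum, ← hz, hzz]
  set s := (Real.sqrt θ)⁻¹ with hs
  have hs2 : s ^ 2 = θ⁻¹ := by rw [hs, inv_pow, Real.sq_sqrt hθ0.le]
  -- normalising factors and the representation
  set r : V → ℝ := fun i => (Real.sqrt (w i ⬝ᵥ w i))⁻¹ with hr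
  have hr2 : ∀ i, w i ≠ 0 → r i ^ 2 * (w i ⬝ᵥ w i) = 1 := fun i hi => by
    have hq : w i ⬝ᵥ w i ≠ 0 := fun h => hi (dotProduct_self_eq_zero.mp h)
    rw [hr, inv_pow, Real.sq_sqrt (hq0 i), inv_mul_cancel₀ hq]
  have hr1 : ∀ i, w i ≠ 0 → Real.sqrt (w i ⬝ᵥ w i) * r i = 1 := fun i hi => by
    have hq : 0 < w i ⬝ᵥ w i :=
      (hq0 i).lt_of_ne fun h => hi (dotProduct_self_eq_zero.mp h.symm)
    rw [hr, mul_inv_cancel₀ (Real.sqrt_pos.mpr hq).ne']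
  set v : V → V ⊕ V → ℝ := fun i =>
    if w i = 0 then Sum.elim 0 (Pi.single i 1) else Sum.elim (r i • w i) 0 with hv
  set d : V ⊕ V → ℝ := Sum.elim (s • z) 0 with hd
  have hBadj : ∀ ⦃i j : V⦄, i ≠ j → ¬Gᶜ.Adj i j → w i ⬝ᵥ w j = 0 := by
    intro i j hij hadj
    rw [hww]
    refine hB.apply_eq_zero (by_contra fun h => hadj ?_)
    exact (SimpleGraph.compl_adj _ _ _).mpr ⟨hij, h⟩
  have hvrep : IsOrthonormalRep Gᶜ v := by
    refine ⟨fun i => ?_, fun i j hij hadj => ?_⟩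
    · by_cases hi : w i = 0
      · simp only [hv, hi, if_true, sumElim_dotProduct_sumElim, dotProduct_zero, single_dotProduct,
          Pi.single_eq_same, one_mul, zero_add]
      · simp only [hv, hi, if_false, sumElim_dotProduct_sumElim, dotProduct_zero, smul_dotProduct,
          dotProduct_smul, smul_eq_mul, add_zero, ← mul_assoc, ← sq, hr2 i hi]
    · have h0 := hBadj hij hadj
      by_cases hi : w i = 0
      · by_cases hj : w j = 0
        · simp only [hv, hi, hj, if_true, sumElim_dotProduct_sumElim, zero_dotProduct,
            single_dotProduct, one_mul, Pi.single_eq_of_ne hij, add_zero]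
        · simp only [hv, hi, hj, if_true, if_false, sumElim_dotProduct_sumElim, zero_dotProduct,
            dotProduct_zero, add_zero]
      · by_cases hj : w j = 0
        · simp only [hv, hi, hj, if_true, if_false, sumElim_dotProduct_sumElim, zero_dotProduct,
            dotProduct_zero, add_zero]
        · simp only [hv, hi, hj, if_false, sumElim_dotProduct_sumElim, dotProduct_zero,
            smul_dotProduct, dotProduct_smul, smul_eq_mul, h0, mul_zero, add_zero]
  have hdd : d ⬝ᵥ d = 1 := by
    rw [hd, sumElim_dotProduct_sumElim, dotProduct_zero, add_zero, smul_dotProduct, dotProduct_smul,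
      smul_eq_mul, smul_eq_mul, hzz, ← mul_assoc, ← sq, hs2, inv_mul_cancel₀ hθ0.ne']
  -- `√q_i · dᵀv_i = s · zᵀw_i` for every `i`
  have hfg : ∀ i, Real.sqrt (w i ⬝ᵥ w i) * (d ⬝ᵥ v i) = s * (z ⬝ᵥ w i) := by
    intro i
    by_cases hi : w i = 0
    · simp [hv, hd, hi]
    · rw [hd, hv]
      simp only [hi, if_false, sumElim_dotProduct_sumElim, zero_dotProduct, add_zero,
        smul_dotProduct, dotProduct_smul, smul_eq_mul]
      calc _ = Real.sqrt (w i ⬝ᵥ w i) * r i * (s * (z ⬝ᵥ w i)) := by ring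
        _ = s * (z ⬝ᵥ w i) := by rw [hr1 i hi, one_mul]
  refine ⟨v, d, hvrep, hdd, le_antisymm (sum_sq_le_lovaszTheta hvrep hdd) ?_⟩
  -- Cauchy–Schwarz: `ϑ = (Σ √q_i dᵀv_i)² ≤ (Σ q_i)(Σ (dᵀv_i)²) = Σ (dᵀv_i)²`
  have hCS := Finset.sum_mul_sq_le_sq_mul_sq Finset.univ (fun i => Real.sqrt (w i ⬝ᵥ w i))
    (fun i => d ⬝ᵥ v i)
  have hl : ∑ i, Real.sqrt (w i ⬝ᵥ w i) * (d ⬝ᵥ v i) = s * θ := by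
    simp_rw [hfg, ← Finset.mul_sum, hzs]
  have hf2 : ∑ i, Real.sqrt (w i ⬝ᵥ w i) ^ 2 = 1 := by
    simp_rw [Real.sq_sqrt (hq0 _), hq1]
  rw [hl, hf2, one_mul] at hCS
  calc θ = (s * θ) ^ 2 := by rw [mul_pow, hs2, sq, ← mul_assoc, inv_mul_cancel₀ hθ0.ne', one_mul]
    _ ≤ ∑ i, (d ⬝ᵥ v i) ^ 2 := hCS

/-- **Lovász's Theorem 5** (1979): `ϑ(G) = max Σ_i (dᵀv_i)²` over orthonormal representations
`(v_i)` of `Ḡ` (here in `ℝ^{V ⊕ V}`, which suffices) and unit vectors `d` — the maximum is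
attained (`exists_isOrthonormalRep_compl_of_lovaszTheta`) and nothing exceeds `ϑ(G)`
(`sum_sq_le_lovaszTheta`, in any dimension); Knuth 1994, §10 (10.1) and §12: `ϑ₄ = ϑ`.
[cite: Lovasz1979, Theorem 5] -/
theorem isGreatest_lovaszTheta_onr_compl [Nonempty V] (G : SimpleGraph V) :
    IsGreatest {x : ℝ | ∃ (v : V → V ⊕ V → ℝ) (d : V ⊕ V → ℝ),
      IsOrthonormalRep Gᶜ v ∧ d ⬝ᵥ d = 1 ∧ x = ∑ i, (d ⬝ᵥ v i) ^ 2} (lovaszTheta G) := by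
  refine ⟨?_, ?_⟩
  · obtain ⟨v, d, hv, hd, h⟩ := exists_isOrthonormalRep_compl_of_lovaszTheta G
    exact ⟨v, d, hv, hd, h.symm⟩
  · rintro x ⟨v, d, hv, hd, rfl⟩
    exact sum_sq_le_lovaszTheta hv hd

end Theorem5

end Literature.Combinatorics.SimpleGraph.LovaszThetaOrthonormal
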